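import Summits.MatrixMultiplication.OmegaCensus.DominoUniformZ4Z4
import HarnessLib

/-!
# Kit for the three-set cube shapes over `A ↠ ℤ₄ × ℤ₄`: the type-`Y` character pair and profile sums

ω-census `pub-omega`, family (b3), seat pub-omega-group gen 17.  Framing: lottery ticket; floor = certified bounds/negative
ranges.  VALUE: the re-usable arithmetic behind the three-set (`(c,c | d,d | e,e)`, all parts `≥ 3`) cells of the Dih
classification over `ℤ₄²`-quotients (`ThreeSetPairZ4Z4.lean`, tables `ThreeSetPairZ4Z4Tables.lean`); NOT progress on ω.

Setting.  A three-set shifted form `(κ₁ − W) + X + Y ⊔ W + (κ₂ − X) + Y ⊔ W + X + (κ₃ − Y) = A ∖ {x₀}` gives, for every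
pulled-back character `ψ` of `ZMod 4 × ZMod 4` (`cube_form_charsum`),
`ψ(κ₁) c̄ a b + ψ(κ₂) c ā b + ψ(κ₃) c a b̄ = −ψ(x₀)` (`c = ψ(W)`, `a = ψ(X)`, `b = ψ(Y)`).  With `β = κ₂ − κ₁`, `γ = κ₃ − κ₁`
the real characters forbid `ψ(β) = ψ(γ) = 1`, so there is a dual pair `w, w'` (`⟨w,β⟩ = 1, ⟨w,γ⟩ = 0, ⟨w',β⟩ = 0, ⟨w',γ⟩ = 1`),
and the two characters `w'` and `w' + 2w` read
`c̄ a b + c ā b + i c a b̄ = −i^l`, `c̄'a'b' − c'ā'b' + i c'a'b̄' = −i^{l+2μ}`.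
Eliminating `b̄` (`det_mul_eq`): `D b = N` with an INTEGER `D`; the kill certificate is non-divisibility
(`N.re % D ≠ 0 ∨ N.im % D ≠ 0`) — `false_of_kill3`.
The pair sees a finite set `Z ⊆ A` only through the eight counts `#{z : ⟨w',φz⟩ = j, 2⟨w,φz⟩ = e}` (`j ∈ ZMod 4`,
`e ∈ {0,2}`); the `sum_*` lemmas below express `ψ_{w'}(Z)`, `ψ_{w'+2w}(Z)` and the three real character sums through them.
-/

namespace Summit.MatrixMultiplication.OmegaCensus

open Finset

/-! ## The single-character test (divisibility obstruction) -/

/-- **`D · b = N`.**  From `c̄ a b + k c ā b + i c a b̄ = r` (`k = ±1`), eliminating `b̄` (`det_mul_eq`) gives `D b = N` with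
`D = conj(P) P − Q conj(Q) ∈ ℤ` (`P = c̄ a + k c ā`, `Q = i c a`) and `N = conj(P) r − Q r̄`; so `D` divides both coordinates of
`N`, and a certificate `N.re % D ≠ 0 ∨ N.im % D ≠ 0` is contradictory. [folklore] -/
theorem false_of_kill3 {c a k r b : GaussianInt}
    (h : star c * a * b + k * c * star a * b + (⟨0, 1⟩ : GaussianInt) * c * a * star b = r)
    (hk : (star (star c * a + k * c * star a) * r - (⟨0, 1⟩ : GaussianInt) * c * a * star r).re %
        (star (star c * a + k * c * star a) * (star c * a + k * c * star a) -
          (⟨0, 1⟩ : GaussianInt) * c * a * star ((⟨0, 1⟩ : GaussianInt) * c * a)).re ≠ 0 ∨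
      (star (star c * a + k * c * star a) * r - (⟨0, 1⟩ : GaussianInt) * c * a * star r).im %
        (star (star c * a + k * c * star a) * (star c * a + k * c * star a) -
          (⟨0, 1⟩ : GaussianInt) * c * a * star ((⟨0, 1⟩ : GaussianInt) * c * a)).re ≠ 0) : False := by
  set P : GaussianInt := star c * a + k * c * star a with hP
  set Q : GaussianInt := (⟨0, 1⟩ : GaussianInt) * c * a with hQ
  have key := det_mul_eq P Q r b (by rw [hP, hQ]; linear_combination h)
  have hD : star P * P - Q * star Q = ⟨(star P * P - Q * star Q).re, 0⟩ := by
    apply Zsqrtd.ext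
    · rfl
    · simp only [Zsqrtd.im_sub, Zsqrtd.im_mul, Zsqrtd.re_star, Zsqrtd.im_star]; ring
  rw [hD] at key
  set N := star P * r - Q * star r with hN
  set D : ℤ := (star P * P - Q * star Q).re with hDd
  have hre : N.re = D * b.re := by rw [← key]; simp
  have him : N.im = D * b.im := by rw [← key]; simp
  rcases hk with hk | hk
  · exact hk (by rw [hre, Int.mul_emod_right])
  · exact hk (by rw [him, Int.mul_emod_right])

/-! ## Pointwise values of the characters `w'`, `w' + 2w`, `2w'`, `2w`, `2(w + w')` through the eight classes -/

section Pointwise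

variable (m n : ZMod 4)

/-- The eight classes `(n = j, 2m = e)` partition. [folklore] -/
theorem pt_total : (1 : ℤ) = (if n = 0 ∧ 2 * m = 0 then 1 else 0) + (if n = 0 ∧ 2 * m = 2 then 1 else 0) +
    (if n = 1 ∧ 2 * m = 0 then 1 else 0) + (if n = 1 ∧ 2 * m = 2 then 1 else 0) +
    (if n = 2 ∧ 2 * m = 0 then 1 else 0) + (if n = 2 ∧ 2 * m = 2 then 1 else 0) +
    (if n = 3 ∧ 2 * m = 0 then 1 else 0) + (if n = 3 ∧ 2 * m = 2 then 1 else 0) := by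
  revert m n; decide

/-- `Re i^n`. [folklore] -/
theorem pt_re_n : (((⟨0, 1⟩ : GaussianInt) ^ n.val).re : ℤ) =
    (if n = 0 ∧ 2 * m = 0 then 1 else 0) + (if n = 0 ∧ 2 * m = 2 then 1 else 0) -
    (if n = 2 ∧ 2 * m = 0 then 1 else 0) - (if n = 2 ∧ 2 * m = 2 then 1 else 0) := by
  revert m n; decide

/-- `Im i^n`. [folklore] -/
theorem pt_im_n : (((⟨0, 1⟩ : GaussianInt) ^ n.val).im : ℤ) =
    (if n = 1 ∧ 2 * m = 0 then 1 else 0) + (if n = 1 ∧ 2 * m = 2 then 1 else 0) -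
    (if n = 3 ∧ 2 * m = 0 then 1 else 0) - (if n = 3 ∧ 2 * m = 2 then 1 else 0) := by
  revert m n; decide

/-- `Re i^(n+2m)`. [folklore] -/
theorem pt_re_n2m : (((⟨0, 1⟩ : GaussianInt) ^ (n + 2 * m).val).re : ℤ) =
    (if n = 0 ∧ 2 * m = 0 then 1 else 0) - (if n = 0 ∧ 2 * m = 2 then 1 else 0) -
    (if n = 2 ∧ 2 * m = 0 then 1 else 0) + (if n = 2 ∧ 2 * m = 2 then 1 else 0) := by
  revert m n; decide

/-- `Im i^(n+2m)`. [folklore] -/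
theorem pt_im_n2m : (((⟨0, 1⟩ : GaussianInt) ^ (n + 2 * m).val).im : ℤ) =
    (if n = 1 ∧ 2 * m = 0 then 1 else 0) - (if n = 1 ∧ 2 * m = 2 then 1 else 0) -
    (if n = 3 ∧ 2 * m = 0 then 1 else 0) + (if n = 3 ∧ 2 * m = 2 then 1 else 0) := by
  revert m n; decide

/-- The real character `2w'`: `i^(2n) = (−1)^n`. [folklore] -/
theorem pt_2n : (⟨0, 1⟩ : GaussianInt) ^ (2 * n).val =
    (((if n = 0 ∧ 2 * m = 0 then 1 else 0) + (if n = 0 ∧ 2 * m = 2 then 1 else 0) -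
    (if n = 1 ∧ 2 * m = 0 then 1 else 0) - (if n = 1 ∧ 2 * m = 2 then 1 else 0) +
    (if n = 2 ∧ 2 * m = 0 then 1 else 0) + (if n = 2 ∧ 2 * m = 2 then 1 else 0) -
    (if n = 3 ∧ 2 * m = 0 then 1 else 0) - (if n = 3 ∧ 2 * m = 2 then 1 else 0) : ℤ) : GaussianInt) := by
  revert m n; decide

/-- The real character `2w`: `i^(2m)`. [folklore] -/
theorem pt_2m : (⟨0, 1⟩ : GaussianInt) ^ (2 * m).val =
    (((if n = 0 ∧ 2 * m = 0 then 1 else 0) - (if n = 0 ∧ 2 * m = 2 then 1 else 0) +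
    (if n = 1 ∧ 2 * m = 0 then 1 else 0) - (if n = 1 ∧ 2 * m = 2 then 1 else 0) +
    (if n = 2 ∧ 2 * m = 0 then 1 else 0) - (if n = 2 ∧ 2 * m = 2 then 1 else 0) +
    (if n = 3 ∧ 2 * m = 0 then 1 else 0) - (if n = 3 ∧ 2 * m = 2 then 1 else 0) : ℤ) : GaussianInt) := by
  revert m n; decide

/-- The real character `2(w + w')`: `i^(2(m+n))`. [folklore] -/
theorem pt_2mn : (⟨0, 1⟩ : GaussianInt) ^ (2 * (m + n)).val =
    (((if n = 0 ∧ 2 * m = 0 then 1 else 0) - (if n = 0 ∧ 2 * m = 2 then 1 else 0) -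
    (if n = 1 ∧ 2 * m = 0 then 1 else 0) + (if n = 1 ∧ 2 * m = 2 then 1 else 0) +
    (if n = 2 ∧ 2 * m = 0 then 1 else 0) - (if n = 2 ∧ 2 * m = 2 then 1 else 0) -
    (if n = 3 ∧ 2 * m = 0 then 1 else 0) + (if n = 3 ∧ 2 * m = 2 then 1 else 0) : ℤ) : GaussianInt) := by
  revert m n; decide

end Pointwise

/-! ## Summed versions: the profile of a finite set -/

section Sums

variable {α : Type*} (s : Finset α) (m n : α → ZMod 4)

/-- The eight classes exhaust `s`. [folklore] -/
theorem sum_total : (s.card : ℤ) = ((s.filter fun x => n x = 0 ∧ 2 * m x = 0).card : ℤ) +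
    (s.filter fun x => n x = 0 ∧ 2 * m x = 2).card + (s.filter fun x => n x = 1 ∧ 2 * m x = 0).card +
    (s.filter fun x => n x = 1 ∧ 2 * m x = 2).card + (s.filter fun x => n x = 2 ∧ 2 * m x = 0).card +
    (s.filter fun x => n x = 2 ∧ 2 * m x = 2).card + (s.filter fun x => n x = 3 ∧ 2 * m x = 0).card +
    (s.filter fun x => n x = 3 ∧ 2 * m x = 2).card := by
  have h : (s.card : ℤ) = ∑ x ∈ s, (1 : ℤ) := by simp
  rw [h, sum_congr rfl fun x _ => pt_total (m x) (n x), sum_add_distrib, sum_add_distrib, sum_add_distrib,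
    sum_add_distrib, sum_add_distrib, sum_add_distrib, sum_add_distrib]
  simp only [sum_boole]

/-- `Re ψ_{w'}(s)`. [folklore] -/
theorem sum_re_n : ((∑ x ∈ s, (⟨0, 1⟩ : GaussianInt) ^ (n x).val).re : ℤ) =
    ((s.filter fun x => n x = 0 ∧ 2 * m x = 0).card : ℤ) + (s.filter fun x => n x = 0 ∧ 2 * m x = 2).card -
    (s.filter fun x => n x = 2 ∧ 2 * m x = 0).card - (s.filter fun x => n x = 2 ∧ 2 * m x = 2).card := by
  rw [gi_re_sum, sum_congr rfl fun x _ => pt_re_n (m x) (n x), sum_sub_distrib, sum_sub_distrib, sum_add_distrib]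
  simp only [sum_boole]

/-- `Im ψ_{w'}(s)`. [folklore] -/
theorem sum_im_n : ((∑ x ∈ s, (⟨0, 1⟩ : GaussianInt) ^ (n x).val).im : ℤ) =
    ((s.filter fun x => n x = 1 ∧ 2 * m x = 0).card : ℤ) + (s.filter fun x => n x = 1 ∧ 2 * m x = 2).card -
    (s.filter fun x => n x = 3 ∧ 2 * m x = 0).card - (s.filter fun x => n x = 3 ∧ 2 * m x = 2).card := by
  rw [gi_im_sum, sum_congr rfl fun x _ => pt_im_n (m x) (n x), sum_sub_distrib, sum_sub_distrib, sum_add_distrib]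
  simp only [sum_boole]

/-- `Re ψ_{w'+2w}(s)`. [folklore] -/
theorem sum_re_n2m : ((∑ x ∈ s, (⟨0, 1⟩ : GaussianInt) ^ (n x + 2 * m x).val).re : ℤ) =
    ((s.filter fun x => n x = 0 ∧ 2 * m x = 0).card : ℤ) - (s.filter fun x => n x = 0 ∧ 2 * m x = 2).card -
    (s.filter fun x => n x = 2 ∧ 2 * m x = 0).card + (s.filter fun x => n x = 2 ∧ 2 * m x = 2).card := by
  rw [gi_re_sum, sum_congr rfl fun x _ => pt_re_n2m (m x) (n x), sum_add_distrib, sum_sub_distrib, sum_sub_distrib]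
  simp only [sum_boole]

/-- `Im ψ_{w'+2w}(s)`. [folklore] -/
theorem sum_im_n2m : ((∑ x ∈ s, (⟨0, 1⟩ : GaussianInt) ^ (n x + 2 * m x).val).im : ℤ) =
    ((s.filter fun x => n x = 1 ∧ 2 * m x = 0).card : ℤ) - (s.filter fun x => n x = 1 ∧ 2 * m x = 2).card -
    (s.filter fun x => n x = 3 ∧ 2 * m x = 0).card + (s.filter fun x => n x = 3 ∧ 2 * m x = 2).card := by
  rw [gi_im_sum, sum_congr rfl fun x _ => pt_im_n2m (m x) (n x), sum_add_distrib, sum_sub_distrib, sum_sub_distrib]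
  simp only [sum_boole]

/-- The real character `2w'` summed. [folklore] -/
theorem sum_2n : ∑ x ∈ s, (⟨0, 1⟩ : GaussianInt) ^ (2 * n x).val =
    ((((s.filter fun x => n x = 0 ∧ 2 * m x = 0).card : ℤ) + (s.filter fun x => n x = 0 ∧ 2 * m x = 2).card -
    (s.filter fun x => n x = 1 ∧ 2 * m x = 0).card - (s.filter fun x => n x = 1 ∧ 2 * m x = 2).card +
    (s.filter fun x => n x = 2 ∧ 2 * m x = 0).card + (s.filter fun x => n x = 2 ∧ 2 * m x = 2).card -
    (s.filter fun x => n x = 3 ∧ 2 * m x = 0).card - (s.filter fun x => n x = 3 ∧ 2 * m x = 2).card : ℤ) :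
      GaussianInt) := by
  rw [sum_congr rfl fun x _ => pt_2n (m x) (n x), ← Int.cast_sum, sum_sub_distrib, sum_sub_distrib, sum_add_distrib,
    sum_add_distrib, sum_sub_distrib, sum_sub_distrib, sum_add_distrib]
  simp only [sum_boole]

/-- The real character `2w` summed. [folklore] -/
theorem sum_2m : ∑ x ∈ s, (⟨0, 1⟩ : GaussianInt) ^ (2 * m x).val =
    ((((s.filter fun x => n x = 0 ∧ 2 * m x = 0).card : ℤ) - (s.filter fun x => n x = 0 ∧ 2 * m x = 2).card +
    (s.filter fun x => n x = 1 ∧ 2 * m x = 0).card - (s.filter fun x => n x = 1 ∧ 2 * m x = 2).card +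
    (s.filter fun x => n x = 2 ∧ 2 * m x = 0).card - (s.filter fun x => n x = 2 ∧ 2 * m x = 2).card +
    (s.filter fun x => n x = 3 ∧ 2 * m x = 0).card - (s.filter fun x => n x = 3 ∧ 2 * m x = 2).card : ℤ) :
      GaussianInt) := by
  rw [sum_congr rfl fun x _ => pt_2m (m x) (n x), ← Int.cast_sum, sum_sub_distrib, sum_add_distrib, sum_sub_distrib,
    sum_add_distrib, sum_sub_distrib, sum_add_distrib, sum_sub_distrib]
  simp only [sum_boole]

/-- The real character `2(w + w')` summed. [folklore] -/
theorem sum_2mn : ∑ x ∈ s, (⟨0, 1⟩ : GaussianInt) ^ (2 * (m x + n x)).val =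
    ((((s.filter fun x => n x = 0 ∧ 2 * m x = 0).card : ℤ) - (s.filter fun x => n x = 0 ∧ 2 * m x = 2).card -
    (s.filter fun x => n x = 1 ∧ 2 * m x = 0).card + (s.filter fun x => n x = 1 ∧ 2 * m x = 2).card +
    (s.filter fun x => n x = 2 ∧ 2 * m x = 0).card - (s.filter fun x => n x = 2 ∧ 2 * m x = 2).card -
    (s.filter fun x => n x = 3 ∧ 2 * m x = 0).card + (s.filter fun x => n x = 3 ∧ 2 * m x = 2).card : ℤ) :
      GaussianInt) := by
  rw [sum_congr rfl fun x _ => pt_2mn (m x) (n x), ← Int.cast_sum, sum_add_distrib, sum_sub_distrib, sum_sub_distrib,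
    sum_add_distrib, sum_add_distrib, sum_sub_distrib, sum_sub_distrib]
  simp only [sum_boole]

end Sums

end Summit.MatrixMultiplication.OmegaCensus
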